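import Mathlib.Algebra.CharP.Lemmas
import Literature.RingTheory.TightClosure.TightClosure
import HarnessLib

/-!
# Power step for tight closure (crux `FrobeniusLadder.FRationalResolution`, line `Sketch`)

Stub `stub_tc_power_step` (worker O1) of the skeleton `Sketch` for crux
stmt-ResolutionOfSingularities-15317, theme O ("in a Cohen–Macaulay local ring ONE tightly closed
parameter ideal makes all of them tightly closed", the CM case of [HochsterHuneke1994, Thm. 4.2 (d)]),
POWER STEP. Let `R` be a commutative ring of prime characteristic `p`, `J ⊆ R` an ideal and `a ∈ R`
a non-zero-divisor modulo every Frobenius power `J^[p^e]` (`e = 0` included: modulo `J`). If the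
ideal `(J, a) = J ⊔ (a)` is tightly closed, then so is `(J, a^M)` for every `M : ℕ`.

Proof (induction on `M`; `M = 0` is `(J, 1) = R`). For the step let `u ∈ (J, a^(M+1))^*` with
witnesses `c ∈ R°`, `e₀`. As `(J, a^(M+1)) ⊆ (J, a^M)` and the latter is tightly closed by induction,
`u = j + r a^M` with `j ∈ J`. For `e ≥ e₀`, `q = p^e`: `(J, b)^[q] = J^[q] + (b^q)` (both sides are
the extension of `(J, b)` along the `e`-th iterate of the Frobenius), so
`c u^q = c j^q + c r^q a^(Mq) = j' + s a^((M+1)q)` with `j' ∈ J^[q]`, i.e.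
`(c r^q - s a^q) a^(Mq) = j' - c j^q ∈ J^[q]`; cancelling `a^(Mq)` (the hypothesis on `a`, `Mq` times)
gives `c r^q ∈ J^[q] + (a^q) = (J, a)^[q]`. Hence `r ∈ (J, a)^* = (J, a)`, `r = j'' + t a`, and
`u = (j + j'' a^M) + t a^(M+1) ∈ (J, a^(M+1))`. (The two auxiliary identities are also the public
helpers `frobeniusPower_sup_span_singleton` / `mem_of_mul_pow_mem` of the sibling exchange step
`…TightClosureExchange`; they are re-derived inline here to keep this file independent of it.)
-/

-- single-problem summit: the doubled namespace component is forced
set_option linter.dupNamespace false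

namespace Summit.ResolutionOfSingularities.ResolutionOfSingularities.Theorems.FRationalResolution

open IsLocalRing Literature.RingTheory.TightClosure

/-- STUB (worker, O1) — **POWER STEP FOR TIGHT CLOSURE.** In a ring of prime characteristic `p`, let
`J` be an ideal and `a` an element that is a non-zero-divisor modulo every Frobenius power `J^[p^e]`
(`e = 0` included: modulo `J`). If `(J, a)` is tightly closed then so is `(J, a^M)` for every `M`.
Induction on `M`: `u ∈ (J, a^(M+1))^* ⊆ (J, a^M)^* = (J, a^M)`, `u = j + r a^M`; then
`c rᵠ a^(Mq) ∈ J^[q] + (a^((M+1)q))` for `q ≫ 0`, so `a^(Mq) (c rᵠ − s aᵠ) ∈ J^[q]`, cancel `a^(Mq)`,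
`c rᵠ ∈ (J, a)^[q]`, `r ∈ (J, a)^* = (J, a)`, `u ∈ (J, a^(M+1))`.
[folklore; cf. HochsterHuneke1994 proof of Thm. 4.2] -/
theorem stub_tc_power_step (p : ℕ) [Fact p.Prime] (R : Type) [CommRing R] [CharP R p]
    (J : Ideal R) (a : R)
    (ha : ∀ (e : ℕ) (z : R), z * a ∈ Literature.RingTheory.TightClosure.frobeniusPower (p ^ e) J →
      z ∈ Literature.RingTheory.TightClosure.frobeniusPower (p ^ e) J)
    (htc : Literature.RingTheory.TightClosure.IsTightlyClosed p (J ⊔ Ideal.span {a})) (M : ℕ) :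
    Literature.RingTheory.TightClosure.IsTightlyClosed p (J ⊔ Ideal.span {a ^ M}) := by
  -- Frobenius powers of `I + (b)`: `(I + (b))^[p^e] = I^[p^e] + (b^(p^e))`
  have hsup : ∀ (e : ℕ) (I : Ideal R) (b : R), frobeniusPower (p ^ e) (I ⊔ Ideal.span {b}) =
      frobeniusPower (p ^ e) I ⊔ Ideal.span {b ^ p ^ e} := fun e I b => by
    rw [frobeniusPower_eq_map_iterateFrobenius, Ideal.map_sup, Ideal.map_span, Set.image_singleton,
      iterateFrobenius_def, ← frobeniusPower_eq_map_iterateFrobenius]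
  -- cancelling powers of `a` modulo `J^[p^e]`
  have hcancel : ∀ (e n : ℕ) (z : R), z * a ^ n ∈ frobeniusPower (p ^ e) J →
      z ∈ frobeniusPower (p ^ e) J := by
    intro e n
    induction n with
    | zero =>
      intro z hz
      rwa [pow_zero, mul_one] at hz
    | succ n ih =>
      intro z hz
      refine ih z (ha e _ ?_)
      rwa [mul_assoc, ← pow_succ]
  induction M with
  | zero =>
    -- `(J, 1) = R` is tightly closed
    rw [pow_zero, Ideal.span_singleton_one, sup_top_eq]
    exact (isTightlyClosed_iff_le p).mpr le_top
  | succ M ih =>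
    rw [isTightlyClosed_iff_le]
    intro u hu
    obtain ⟨c, hc, e₀, he⟩ := (mem_tightClosure_iff p).mp hu
    -- `(J, a^(M+1)) ⊆ (J, a^M)`, so `u ∈ (J, a^M)^* = (J, a^M)` by the induction hypothesis
    have hle : J ⊔ Ideal.span {a ^ (M + 1)} ≤ J ⊔ Ideal.span {a ^ M} :=
      sup_le_sup_left (Ideal.span_singleton_le_span_singleton.mpr ⟨a, pow_succ a M⟩) _
    have huM : u ∈ J ⊔ Ideal.span {a ^ M} := ih.le (tightClosure_mono p hle hu)
    obtain ⟨j, hj, r', hr', hju⟩ := Submodule.mem_sup.mp huM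
    obtain ⟨r, rfl⟩ := Ideal.mem_span_singleton'.mp hr'
    -- `r ∈ (J, a)^*`, with the same witnesses `c`, `e₀`
    have hr : r ∈ tightClosure p (J ⊔ Ideal.span {a}) := by
      refine (mem_tightClosure_iff p).mpr ⟨c, hc, e₀, fun e hee => ?_⟩
      have h1 := he e hee
      rw [hsup e] at h1 ⊢
      obtain ⟨j', hj', s', hs', hjs⟩ := Submodule.mem_sup.mp h1
      obtain ⟨s, rfl⟩ := Ideal.mem_span_singleton'.mp hs'
      -- `c u^q = c j^q + c r^q a^(Mq) = j' + s a^((M+1)q)`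
      have hupow : u ^ p ^ e = j ^ p ^ e + r ^ p ^ e * (a ^ M) ^ p ^ e := by
        rw [← hju, add_pow_expChar_pow, mul_pow]
      have hjq : c * j ^ p ^ e ∈ frobeniusPower (p ^ e) J :=
        Ideal.mul_mem_left _ _ (pow_mem_frobeniusPower hj)
      have hkey : (c * r ^ p ^ e - s * a ^ p ^ e) * a ^ (M * p ^ e) ∈ frobeniusPower (p ^ e) J := by
        have h2 : (c * r ^ p ^ e - s * a ^ p ^ e) * a ^ (M * p ^ e) = j' - c * j ^ p ^ e := by
          have hj'eq : j' = c * u ^ p ^ e - s * (a ^ (M + 1)) ^ p ^ e := by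
            rw [← hjs]; ring
          rw [hj'eq, hupow]
          ring
        rw [h2]
        exact sub_mem hj' hjq
      have h3 : c * r ^ p ^ e - s * a ^ p ^ e ∈ frobeniusPower (p ^ e) J :=
        hcancel e (M * p ^ e) _ hkey
      have h4 : c * r ^ p ^ e = (c * r ^ p ^ e - s * a ^ p ^ e) + s * a ^ p ^ e := by ring
      rw [h4]
      exact add_mem (Ideal.mem_sup_left h3)
        (Ideal.mem_sup_right (Ideal.mem_span_singleton'.mpr ⟨s, rfl⟩))
    -- `r ∈ (J, a)`, so `u = j + r a^M ∈ (J, a^(M+1))`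
    have hrJ : r ∈ J ⊔ Ideal.span {a} := htc.le hr
    obtain ⟨j'', hj'', t', ht', hjt⟩ := Submodule.mem_sup.mp hrJ
    obtain ⟨t, rfl⟩ := Ideal.mem_span_singleton'.mp ht'
    rw [← hju, ← hjt]
    have h5 : j + (j'' + t * a) * a ^ M = (j + a ^ M * j'') + t * a ^ (M + 1) := by ring
    rw [h5]
    exact add_mem (Ideal.mem_sup_left (add_mem hj (Ideal.mul_mem_left _ _ hj'')))
      (Ideal.mem_sup_right (Ideal.mem_span_singleton'.mpr ⟨t, rfl⟩))

end Summit.ResolutionOfSingularities.ResolutionOfSingularities.Theorems.FRationalResolution
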